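import Mathlib
import HarnessLib
import Summits.NavierStokesRegularity.NavierStokesRegularity.Theorems.TypeIQuarterGateScarEnvelopeTypeIForcedTsaiAlgSoundG
import Summits.NavierStokesRegularity.NavierStokesRegularity.Theorems.TypeIQuarterGateScarEnvelopeTypeIForcedTsaiAlgWitnessLB8
import Summits.NavierStokesRegularity.NavierStokesRegularity.Theorems.TypeIQuarterGateScarEnvelopeTypeIForcedTsaiAlgWitnessLB16

/-!
# ARM B lane E-exact — LARGER-BASIS Type-I rows (eng-3 g2 j319388, certified by the cert hand), EXACT WEIGHT, AS TREE THEOREMS: δ/M = 16.99 @8 · 18.29 @16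

Closers of kernel-checked LANEX-ALG v3 rows — here the LARGER-BASIS witnesses of ns-wall-eng-3 g2 (kit job j319388; cell ns-wall-extremal,
exp-lead RELEASE «LANEX-ALG-LB» 2026-08-28T22:15:09Z, idea-crit-7 NOD; certifier = cert hand ns-crc-p2 g6) — (Type-I-tail witnesses with exact far-field closure, the CERTIFIED
POLYNOMIAL LEVEL FLOOR `floorCertT3K30`, and the EXACT residual weight `(1+ρ)⁵` — no AM-GM majorant) through
`AlgRowG.sound` (`…ForcedTsaiAlgSoundG`): certified UPPER bounds on the forced-Tsai modulus in the tree currency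
(`ℝ³`, weight `(1+ρ)⁵`, level on `B₁₀`):
`δ*(8) ≤ 135.9` (δ/M = 16.99; same vector under the v2 functional 17.56); `δ*(16) ≤ 292.6` (δ/M = 18.29; same vector under the v2 functional 19.02).
«Near-profiles this good EXIST»; UPPER bounds only; excludes nothing; nothing about NS regularity; 23843 / H3 OPEN.
-/

set_option linter.dupNamespace false

namespace Summit.NavierStokesRegularity.NavierStokesRegularity.Cruxes.ScarEnvelopeTypeI.ForcedTsai

/-- `δ*(8) ≤ 27179/200` ≈ 135.8950 (Type-I-tail class, exact closure, certified polynomial floor, EXACT weight; δ/M = 16.99; same vector under the v2 functional 17.56). -/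
theorem forcedTsaiModulusLE_algG_LB_8 : ForcedTsaiModulusLE (8 : ℝ) (27179 / 200 : ℝ) := by
  have h := algRowGLB8r0.sound algRowGLB8r0_checkG
  have hM : algRowGLB8r0.M = 8 := rfl
  have hδ : algRowGLB8r0.δ = (27179 / 200) := rfl
  rw [hM, hδ] at h
  push_cast at h
  exact h

/-- `δ*(16) ≤ 292617/1000` ≈ 292.6170 (Type-I-tail class, exact closure, certified polynomial floor, EXACT weight; δ/M = 18.29; same vector under the v2 functional 19.02). -/
theorem forcedTsaiModulusLE_algG_LB_16 : ForcedTsaiModulusLE (16 : ℝ) (292617 / 1000 : ℝ) := by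
  have h := algRowGLB16r0.sound algRowGLB16r0_checkG
  have hM : algRowGLB16r0.M = 16 := rfl
  have hδ : algRowGLB16r0.δ = (292617 / 1000) := rfl
  rw [hM, hδ] at h
  push_cast at h
  exact h

/-- Rounded: `ForcedTsaiModulusLE 16 293` (`δ/M ≤ 18.32` at level 16 — the ns-wall-extremal cell's LANEX-ALG-LB row; cf. `…_16_298`
(60-element witness, exact weight) and `…_16_309` (v2)). -/
theorem forcedTsaiModulusLE_16_293 : ForcedTsaiModulusLE (16 : ℝ) (293 : ℝ) :=
  forcedTsaiModulusLE_algG_LB_16.mono le_rfl (by norm_num)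

end Summit.NavierStokesRegularity.NavierStokesRegularity.Cruxes.ScarEnvelopeTypeI.ForcedTsai
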